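/-
Copyright (c) 2026 the pub-hodgecm-mathlib formalisation cell (harness21).  Typer∕survey seat hodgecm-mathlib-typ-T5b (g0), topic T5 = P8
«(C♯)hol interior», 2026-08-31.  KERNEL module: THEOREMS ONLY (no definition, no named fact, no instance, no notation, no `sorry`).
-/
import Literature.NumberTheory.Automorphic.Liu2021.ThetaLiftFromLineCharacters
import Literature.NumberTheory.Automorphic.UnitaryGroupDiscreteRepCentralCharacter
import Literature.NumberTheory.Automorphic.UnitaryGroupHolCotFormsArchCentre
import Literature.NumberTheory.Automorphic.DiscreteSummandProjection
import Literature.NumberTheory.Automorphic.UnitaryGroupAdelicCenter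
import HarnessLib

-- As in the lineage (`ThetaLiftFromLineCharacters`, `UnitaryDualPairThetaLiftCharacterSpan`): statements over the theta-kernel datum
-- elaborate to very large types; elaborate sequentially.
set_option Elab.async false

/-!
# The central character of `P` read on the line `U(⟨a⟩)`: «`χ` = the central character of `π`» and «`χ_∞ = 1`» for theta vectors

Topic `NumberTheory/Automorphic/Liu2021`; namespace `Literature.NumberTheory.Automorphic.Liu2021`.  THEOREMS ONLY.  Cell hodgecm-mathlib
FLOOR 0, programme P2, topic T5 = P8 (interior of letter #87 (C♯)hol along [Liu2021, Prop. 4.13 proof Case 1]): the GLUE between node B's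
theta half (★ `ThetaLiftFromLineCharacters`: the seam `MeetsThetaLiftFromLine` yields a continuous unitary CHARACTER `χ̃` of `[U(⟨a⟩)]` with
`pr_P [Θ̃_Φ(χ̃) ∘ ιA] ≠ 0`) and the central character of `P` (★ `UnitaryGroupDiscreteRepCentralCharacter` (B3-core), ★
`UnitaryGroupHolCotFormsArchCentre` (B4)).  Liu [FJcycle.tex l. 2136–2137; Camb. J. Math. 9 (2021) p. 48]: «… `V_π = Θ^V_{(μ⁻¹,ν⁻¹),−W}(π_W)`.
Note that the central character `χ` of `π` satisfies `χ_∞ = 1`.  In other words … `π^∞ ≃ ω(μ, ε_e, χ)`» — the character indexing the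
co-invariants `ω(μ, ε, χ)` ([Liu2021, Def. 4.11; App. D §D.1 Step 3]) IS the central character of `π`, because `U(W) = U(1)` and the centre of
`U(V)` have the SAME image in the big unitary group `U(V ⊗ W)` ([GelbartRogawski1991, §3.1]: `(u·1_V) ⊗ 1 = 1 ⊗ (u·1_W)`), so every pair
splitting restricted from `U(V ⊗ W)(𝔸)` — in particular the `μ`-attached splitting ★ `chiSplittingLine` of the seam — gives
`ω(u·1_V, 1) = ω(1, u·1_W)`; hence a theta vector `[Θ̃_Φ(χ̃) ∘ ιA]` transforms under the centre `u·1_H` of `U(H)(𝔸_{L⁺})` (carried by `ιA` to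
`u·1_{diag dV}`, §1) through `χ̃([u·1_W])` (§3), and if its projection to the irreducible `P` is non-zero then `ψ_P(u) = χ̃([u·1_W])` (§4);
with B4 («`ψ_P` is trivial on the archimedean centre for a holomorphic-cotangent `P`») the theta character `χ̃` has TRIVIAL ARCHIMEDEAN TYPE
(§5) — it descends to Liu's finite index set `L¹\(𝔸_L^∞)¹` (★ `Def411WeilCarriers.Chi`; the descent itself is ★ `RelNormOneCharacterFromFiniteCentre`'s
business and is not repeated here).

* §1 `frameTransport_adelicCenter` — any transport `ιA` with (C♯)hol's matrix formula fixes the centre: `ιA (u·1_H) = u·1_{diag dV}`;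
* §2 `adelicInl_adelicCenter_eq_adelicInr_adelicCenter` (`(u·1_V) ⊗ 1 = 1 ⊗ (u·1_W)`), `pairSplitting_adelicCenter_fst_eq_snd`,
  `pairRep_adelicCenter_fst_eq_snd` (`ω_ψ(s(u·1_V, 1)) = ω_ψ(s(1, u·1_W))` for EVERY `s` on the big group) — generic over `(F, E, c, N, M, J_V, J_W)`;
* §3 **`rightRegular_adelicCenter_toLp_lineThetaLift_charCM`** — `R(u·1_H) [Θ̃_Φ(χ̃) ∘ ιA] = χ̃([u·1_W]) • [Θ̃_Φ(χ̃) ∘ ιA]` in `L²([U(H)], ν)`;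
* §4 **`centralCharacter_eq_charCM`** — if the centre acts on `P` through `ψ` and `pr_P [Θ̃_Φ(χ̃) ∘ ιA] ≠ 0` then `ψ(u) = χ̃([u·1_W])` for all `u`;
* §5 **`charCM_archCentre_eq_one_of_holCotForm`** — for `N = 3` in (C♯)hol's frame: if moreover `P` contains the coordinates of a holomorphic
  cotangent form with a non-zero class, then `χ̃([(y,1)·1_W]) = 1` for every archimedean norm-one unit `y` («`χ_∞ = 1`» for the theta character).

HONEST SCOPE.  No statement about the finite component (node B's co-invariant junction B5 and injectivity B7 are elsewhere); the non-vanishing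
inputs (`pr_P(θ-vector) ≠ 0`, ★ `MeetsThetaLiftFromLine.exists_charCM_starProjection_ne_zero`; a non-zero class of a cotangent form) are
HYPOTHESES here.  HC_CM is proved only modulo the printed citations until rung 0 closes; this file books nothing and discharges nothing booked
(it pays in-house glue of node B).

## References
* [Liu2021] Y. Liu, Camb. J. Math. 9 (2021), proof of Prop. 4.13 Case 1 (l. 2136–2137, p. 48); Def. 4.11; App. D §D.1 Step 3.
* [GelbartRogawski1991] S. Gelbart, J. Rogawski, Invent. Math. 105 (1991), §3.1 Prop. 3.1.1 p. 455 and Remark p. 457; §3.2 p. 457.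
* [Mok2014] C. P. Mok, Mem. AMS 235 (2015), §1 Notation p. 5 (centre of `U_{E/F}(N)` = `U_{E/F}(1)`).
* [BorelJacquet1979] A. Borel, H. Jacquet, PSPM 33.1 (1979), §4.6.
-/

set_option autoImplicit false

noncomputable section

open NumberField MeasureTheory IsDedekindDomain
open scoped Matrix Kronecker ComplexOrder ENNReal

namespace Literature.NumberTheory.Automorphic.Liu2021

open _root_.MeasureTheory
open Literature.NumberTheory.Automorphic Literature.NumberTheory.Automorphic.UnitaryGroup
open Literature.NumberTheory.Automorphic.UnitaryGroup.CotangentForms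
open Literature.NumberTheory.Automorphic.IdeleClassGroup
open Literature.NumberTheory.Automorphic.Liu2021.Def411WeilCarriers
open Literature.NumberTheory.Automorphic.Liu2021.Def411WeilCarriersDoubling
open Literature.NumberTheory.GelbartRogawski1991 Literature.NumberTheory.GelbartRogawski1991.UnitaryDualPair
open Literature.NumberTheory.Weil1964
open Literature.RepresentationTheory.Liu2021
open Literature.RepresentationTheory.CompactGroups
open Literature.RepresentationTheory.HeisenbergGroup

/-! ## §1 Frame transports fix the centre -/

section Transport

variable (L : Type) [Field L] [NumberField L] [IsCMField L] (N : ℕ) (H : Matrix (Fin N) (Fin N) L) (dV : Fin N → L) (g : GL (Fin N) L)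

/-- **A frame transport fixes the centre**: if `↑(ιA k) = g_𝔸⁻¹ · k · g_𝔸` for all `k` (the hypothesis `hιA` of (C♯)hol ∕ letter A ∕ node B)
then `ιA (u · 1_N) = u · 1_N` — scalar matrices commute with `g_𝔸`. [cite: Mok2014, §1 Notation p. 5] -/
theorem frameTransport_adelicCenter
    (ιA : (adelicGroupData (↥(maximalRealSubfield L)) L (IsCMField.complexConj L) N H).Adelic →*
      ↥(UnitaryGroup.adelic (↥(maximalRealSubfield L)) L (IsCMField.complexConj L) N (Matrix.diagonal dV)))
    (hιA : ∀ k, ((ιA k : ↥(UnitaryGroup.adelic (↥(maximalRealSubfield L)) L (IsCMField.complexConj L) N (Matrix.diagonal dV))) :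
        GL (Fin N) (AdeleRing (𝓞 L) L)) =
      (toAdeleGL L g)⁻¹ * adelicVal (↥(maximalRealSubfield L)) L (IsCMField.complexConj L) N H k * toAdeleGL L g)
    (u : ↥(adelicOne (↥(maximalRealSubfield L)) L (IsCMField.complexConj L))) :
    ιA (adelicCenter (↥(maximalRealSubfield L)) L (IsCMField.complexConj L) N H u) =
      adelicCenter (↥(maximalRealSubfield L)) L (IsCMField.complexConj L) N (Matrix.diagonal dV) u := by
  apply Subtype.ext
  apply Units.ext
  rw [hιA, adelicVal_apply, Units.val_mul, Units.val_mul, coe_adelicCenter, coe_adelicCenter, Matrix.mul_smul, Matrix.mul_one,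
    Matrix.smul_mul, ← Units.val_mul, inv_mul_cancel, Units.val_one]

end Transport

/-! ## §2 The anti-diagonal centre: `ω(u·1_V, 1) = ω(1, u·1_W)` for every pair splitting on the big group -/

section AntiDiagonal

variable (F E : Type) [Field F] [NumberField F] [Field E] [NumberField E] [Algebra F E] (c : E ≃ₐ[F] E) (N M : ℕ) {n : ℕ}
  (e : Fin N × Fin M ≃ Fin n) (JV : Matrix (Fin N) (Fin N) E) (JW : Matrix (Fin M) (Fin M) E)
  {TV : Matrix (Fin N) (Fin N) F} {TW : Matrix (Fin M) (Fin M) F}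

omit [NumberField F] in
/-- **The two centres agree in the big unitary group**: `(u · 1_V) ⊗ 1 = 1 ⊗ (u · 1_W)` in `G₁(𝔸_F) = U(J_V ⊗ J_W)(𝔸_F)` (both are the scalar
`u` on `𝔸_E^{N M}`; cf. ★ `adelicInl_adelicCenter_mul_adelicInr_adelicCenter_inv`). [cite: GelbartRogawski1991, §3.1 Prop. 3.1.1 p. 455] -/
theorem adelicInl_adelicCenter_eq_adelicInr_adelicCenter (u : ↥(adelicOne F E c)) :
    adelicInl F E c N M JV JW (adelicCenter F E c N JV u) = adelicInr F E c N M JV JW (adelicCenter F E c M JW u) := by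
  apply Subtype.ext
  apply Units.ext
  rw [coe_adelicInl, coe_adelicInr, coe_adelicCenter, coe_adelicCenter, Matrix.smul_kronecker, Matrix.kronecker_smul]

omit [NumberField F] in
/-- `a(u·1_V) · b(1) = a(1) · b(u·1_W)` in `G₁(𝔸_F)`. [cite: GelbartRogawski1991, §3.1 Prop. 3.1.1 p. 455] -/
theorem adelicInl_adelicCenter_mul_one_eq (u : ↥(adelicOne F E c)) :
    adelicInl F E c N M JV JW (adelicCenter F E c N JV u) * adelicInr F E c N M JV JW 1 =
      adelicInl F E c N M JV JW 1 * adelicInr F E c N M JV JW (adelicCenter F E c M JW u) := by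
  rw [(adelicInr F E c N M JV JW).map_one, (adelicInl F E c N M JV JW).map_one, mul_one, one_mul]
  exact adelicInl_adelicCenter_eq_adelicInr_adelicCenter F E c N M JV JW u

set_option maxHeartbeats 800000 in
/-- **`s(u·1_V, 1) = s(1, u·1_W)`** for EVERY homomorphism `s` on the big group `G₁(𝔸_F)`, read on the pair through ★ `pairSplitting`
(`(x, y) ↦ s(a(x) b(y))`). [cite: GelbartRogawski1991, §3.1 Prop. 3.1.1 p. 455; §3.1 Remark p. 457] -/
theorem pairSplitting_adelicCenter_fst_eq_snd
    (s : UnitaryGroup.adelicPair F E c N M JV JW →* adelicMpCont F (Fin n) (adelicGram F e TV TW)) (u : ↥(adelicOne F E c)) :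
    pairSplitting F E c N M e JV JW s (adelicCenter F E c N JV u, 1) = pairSplitting F E c N M e JV JW s (1, adelicCenter F E c M JW u) := by
  rw [pairSplitting_apply, pairSplitting_apply]
  exact congrArg s (adelicInl_adelicCenter_mul_one_eq F E c N M JV JW u)

set_option maxHeartbeats 800000 in
/-- **`ω_ψ(s(u·1_V, 1)) = ω_ψ(s(1, u·1_W))`**: the Weil representation of the pair (★ `pairRep`) cannot distinguish the centre of `U(V)`
from `U(W)`'s copy of `U(1)`. [cite: GelbartRogawski1991, §3.1 Prop. 3.1.1 p. 455; §3.1 Remark p. 457] -/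
theorem pairRep_adelicCenter_fst_eq_snd
    (s : UnitaryGroup.adelicPair F E c N M JV JW →* adelicMpCont F (Fin n) (adelicGram F e TV TW)) (u : ↥(adelicOne F E c))
    (Φ : piSchwartzBruhat F (Fin n)) :
    pairRep F E c N M e JV JW s (adelicCenter F E c N JV u, 1) Φ = pairRep F E c N M e JV JW s (1, adelicCenter F E c M JW u) Φ :=
  congrArg (fun m => adelicMpCont.omega F (Fin n) (adelicGram F e TV TW) m Φ) (pairSplitting_adelicCenter_fst_eq_snd F E c N M e JV JW s u)

end AntiDiagonal

/-! ## §3 Theta vectors transform under the centre of `U(H)` through the theta character -/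

section Seam

variable (L : Type) [Field L] [NumberField L] [IsCMField L] (N : ℕ) (H : Matrix (Fin N) (Fin N) L)
  {n' : ℕ} (e₁ : Fin N × Fin 1 ≃ Fin n') (dV : Fin N → L) (hdV : ∀ i, IsCMField.complexConj L (dV i) = dV i)
  (hdV0 : ∀ i, dV i ≠ 0) (g : GL (Fin N) L)
  (hg : ((g : Matrix (Fin N) (Fin N) L).map (cmConjRingHom L))ᵀ * H * (g : Matrix (Fin N) (Fin N) L) = Matrix.diagonal dV)
  (μ : Literature.NumberTheory.Automorphic.IdeleClassGroup L →ₜ* Circle) (hμ : IsConjugateSymplectic L μ) (a : (↥(maximalRealSubfield L))ˣ)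
  (hρ : HasThetaMajorants fun
      (p : ↥(UnitaryGroup.adelic (↥(maximalRealSubfield L)) L (IsCMField.complexConj L) N (Matrix.diagonal dV)) × ↥(UnitaryGroup.adelic (↥(maximalRealSubfield L)) L (IsCMField.complexConj L) 1 (JW (↥(maximalRealSubfield L)) L a))) (Φ : piSchwartzBruhat (↥(maximalRealSubfield L)) (Fin n')) => (pairRep (↥(maximalRealSubfield L)) L (IsCMField.complexConj L) N 1 e₁ (Matrix.diagonal dV) (JW (↥(maximalRealSubfield L)) L a)
          (chiSplittingLine L e₁ dV hdV hdV0 (toHeckeCharacter L μ) (isUnitary_toHeckeCharacter L μ)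
            ((isOscillatorChar_toHeckeCharacter_iff μ).mpr hμ) (TW (↥(maximalRealSubfield L)) a)
            (isUnit_det_TW (↥(maximalRealSubfield L)) a) (JW (↥(maximalRealSubfield L)) L a) (JW_eq (↥(maximalRealSubfield L)) L a))) p Φ)

variable
  [CompactSpace (↥(UnitaryGroup.adelic (↥(maximalRealSubfield L)) L (IsCMField.complexConj L) N (Matrix.diagonal dV)) ⧸ (UnitaryGroup.toAdelic (↥(maximalRealSubfield L)) L (IsCMField.complexConj L) N (Matrix.diagonal dV)).range)] [MeasurableSpace (↥(UnitaryGroup.adelic (↥(maximalRealSubfield L)) L (IsCMField.complexConj L) 1 (JW (↥(maximalRealSubfield L)) L a)) ⧸ (UnitaryGroup.toAdelic (↥(maximalRealSubfield L)) L (IsCMField.complexConj L) 1 (JW (↥(maximalRealSubfield L)) L a)).range)] (μW : Measure (↥(UnitaryGroup.adelic (↥(maximalRealSubfield L)) L (IsCMField.complexConj L) 1 (JW (↥(maximalRealSubfield L)) L a)) ⧸ (UnitaryGroup.toAdelic (↥(maximalRealSubfield L)) L (IsCMField.complexConj L) 1 (JW (↥(maximalRealSubfield L)) L a)).range))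
  (Φ : piSchwartzBruhat (↥(maximalRealSubfield L)) (Fin n'))

variable [BorelSpace (↥(UnitaryGroup.adelic (↥(maximalRealSubfield L)) L (IsCMField.complexConj L) 1 (JW (↥(maximalRealSubfield L)) L a)) ⧸ (UnitaryGroup.toAdelic (↥(maximalRealSubfield L)) L (IsCMField.complexConj L) 1 (JW (↥(maximalRealSubfield L)) L a)).range)] [IsFiniteMeasure μW]
  [SMulInvariantMeasure ↥(UnitaryGroup.adelic (↥(maximalRealSubfield L)) L (IsCMField.complexConj L) 1 (JW (↥(maximalRealSubfield L)) L a)) (↥(UnitaryGroup.adelic (↥(maximalRealSubfield L)) L (IsCMField.complexConj L) 1 (JW (↥(maximalRealSubfield L)) L a)) ⧸ (UnitaryGroup.toAdelic (↥(maximalRealSubfield L)) L (IsCMField.complexConj L) 1 (JW (↥(maximalRealSubfield L)) L a)).range) μW]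

set_option maxHeartbeats 1600000 in
/-- **Theta vectors transform under the centre of `U(H)` through the theta character**: for a continuous unitary character `χ̃` of
`[U(⟨a⟩)]`, a Schwartz–Bruhat `Φ` and `u ∈ U(1)(𝔸_{L⁺})`,
`R(u·1_H) [Θ̃_Φ(χ̃) ∘ ιA] = χ̃([u·1_W]) • [Θ̃_Φ(χ̃) ∘ ιA]` in `L²([U(H)], ν)` — equivariance (★ `rightRegular_toLp_lineThetaLift`), the
transport fixes the centre (§1), the anti-diagonal identity `ω(u·1_V, 1) = ω(1, u·1_W)` (§2) and `χ̃`-covariance in the Schwartz variable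
(★ `toLp_lineThetaLift_pairRep_one_charCM`). [cite: GelbartRogawski1991, §3.1 Prop. 3.1.1 p. 455; §3.2 p. 457] [cite: Liu2021, proof of Prop. 4.13 Case 1 l. 2136–2137] -/
theorem rightRegular_adelicCenter_toLp_lineThetaLift_charCM
    [CompactSpace (adelicGroupData (↥(maximalRealSubfield L)) L (IsCMField.complexConj L) N H).automorphicQuotient]
    (ν : Measure (adelicGroupData (↥(maximalRealSubfield L)) L (IsCMField.complexConj L) N H).automorphicQuotient) [IsFiniteMeasure ν]
    [SMulInvariantMeasure (adelicGroupData (↥(maximalRealSubfield L)) L (IsCMField.complexConj L) N H).Adelic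
      (adelicGroupData (↥(maximalRealSubfield L)) L (IsCMField.complexConj L) N H).automorphicQuotient ν]
    (u : ↥(adelicOne (↥(maximalRealSubfield L)) L (IsCMField.complexConj L))) :
    haveI := normal_range_toAdelic_JW L a
    ∀ χ : PontryaginDual (↥(UnitaryGroup.adelic (↥(maximalRealSubfield L)) L (IsCMField.complexConj L) 1 (JW (↥(maximalRealSubfield L)) L a)) ⧸ (UnitaryGroup.toAdelic (↥(maximalRealSubfield L)) L (IsCMField.complexConj L) 1 (JW (↥(maximalRealSubfield L)) L a)).range),
      (adelicGroupData (↥(maximalRealSubfield L)) L (IsCMField.complexConj L) N H).rightRegular ν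
          (adelicCenter (↥(maximalRealSubfield L)) L (IsCMField.complexConj L) N H u)
          (MemLp.toLp _ (memLp_toQuotFun_lineThetaLift L N H e₁ dV hdV hdV0 g hg μ hμ a hρ μW Φ (charCM χ) ν 2)) =
        ((χ (QuotientGroup.mk (adelicCenter (↥(maximalRealSubfield L)) L (IsCMField.complexConj L) 1 (JW (↥(maximalRealSubfield L)) L a) u)) : Circle) : ℂ) •
          MemLp.toLp _ (memLp_toQuotFun_lineThetaLift L N H e₁ dV hdV hdV0 g hg μ hμ a hρ μW Φ (charCM χ) ν 2) := by
  haveI := normal_range_toAdelic_JW L a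
  intro χ
  rw [rightRegular_toLp_lineThetaLift,
    frameTransport_adelicCenter L N H dV g (cmAdelicFrameTransport L N H dV g hg) (coe_cmAdelicFrameTransport L N H dV g hg) u,
    pairRep_adelicCenter_fst_eq_snd]
  exact toLp_lineThetaLift_pairRep_one_charCM L N H e₁ dV hdV hdV0 g hg μ hμ a hρ μW Φ ν _ χ

/-! ## §4 «`χ` = the central character of `π`» -/

set_option maxHeartbeats 1600000 in
/-- **The theta character IS the central character** [Liu2021, l. 2137 «the central character `χ` of `π`»]: if the centre `u ↦ u·1_H` acts
on the discrete automorphic `P` through `ψ` (★ `DiscreteAutomorphicRep.exists_centralCharacter_adelicCenter`) and the projection to `P` of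
the theta vector `[Θ̃_Φ(χ̃) ∘ ιA]` is non-zero (★ `MeetsThetaLiftFromLine.exists_charCM_starProjection_ne_zero`), then
`ψ(u) = χ̃([u·1_W])` for EVERY `u ∈ U(1)(𝔸_{L⁺})` (the projection `pr_P` commutes with `R`, ★ `ClosedSubrep.starProjection_map_apply`, and §3).
[cite: Liu2021, proof of Prop. 4.13 Case 1 l. 2136–2137] [cite: GelbartRogawski1991, §3.1 Remark p. 457] -/
theorem centralCharacter_eq_charCM
    [CompactSpace (adelicGroupData (↥(maximalRealSubfield L)) L (IsCMField.complexConj L) N H).automorphicQuotient]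
    (ν : Measure (adelicGroupData (↥(maximalRealSubfield L)) L (IsCMField.complexConj L) N H).automorphicQuotient)
    [(adelicGroupData (↥(maximalRealSubfield L)) L (IsCMField.complexConj L) N H).IsAutomorphicMeasure ν]
    (P : DiscreteAutomorphicRep (adelicGroupData (↥(maximalRealSubfield L)) L (IsCMField.complexConj L) N H) ν)
    {ψ : ↥(adelicOne (↥(maximalRealSubfield L)) L (IsCMField.complexConj L)) →* ℂˣ}
    (hψ : ∀ (u : ↥(adelicOne (↥(maximalRealSubfield L)) L (IsCMField.complexConj L))) (f : P.space.toSubmodule),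
      P.space.toContRep (adelicCenter (↥(maximalRealSubfield L)) L (IsCMField.complexConj L) N H u) f = ((ψ u : ℂˣ) : ℂ) • f) :
    haveI := normal_range_toAdelic_JW L a
    ∀ (χ : PontryaginDual (↥(UnitaryGroup.adelic (↥(maximalRealSubfield L)) L (IsCMField.complexConj L) 1 (JW (↥(maximalRealSubfield L)) L a)) ⧸ (UnitaryGroup.toAdelic (↥(maximalRealSubfield L)) L (IsCMField.complexConj L) 1 (JW (↥(maximalRealSubfield L)) L a)).range)),
      P.space.toSubmodule.starProjection
          (MemLp.toLp _ (memLp_toQuotFun_lineThetaLift L N H e₁ dV hdV hdV0 g hg μ hμ a hρ μW Φ (charCM χ) ν 2)) ≠ 0 →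
      ∀ u : ↥(adelicOne (↥(maximalRealSubfield L)) L (IsCMField.complexConj L)),
        ((ψ u : ℂˣ) : ℂ) =
          ((χ (QuotientGroup.mk (adelicCenter (↥(maximalRealSubfield L)) L (IsCMField.complexConj L) 1 (JW (↥(maximalRealSubfield L)) L a) u)) : Circle) : ℂ) := by
  haveI := normal_range_toAdelic_JW L a
  intro χ hpr u
  set v := MemLp.toLp _ (memLp_toQuotFun_lineThetaLift L N H e₁ dV hdV hdV0 g hg μ hμ a hρ μW Φ (charCM χ) ν 2) with hv
  set w := P.space.toSubmodule.starProjection v with hw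
  have hwmem : w ∈ P.space.toSubmodule := Submodule.starProjection_apply_mem _ v
  -- `R(u·1_H) w = χ̃([u·1_W]) • w` (the projection commutes with the unitary `R`)
  have hR : (adelicGroupData (↥(maximalRealSubfield L)) L (IsCMField.complexConj L) N H).rightRegular ν
      (adelicCenter (↥(maximalRealSubfield L)) L (IsCMField.complexConj L) N H u) w =
      ((χ (QuotientGroup.mk (adelicCenter (↥(maximalRealSubfield L)) L (IsCMField.complexConj L) 1 (JW (↥(maximalRealSubfield L)) L a) u)) : Circle) : ℂ) • w := by
    rw [hw, ← ContRepresentation.ClosedSubrep.starProjection_map_apply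
      ((adelicGroupData (↥(maximalRealSubfield L)) L (IsCMField.complexConj L) N H).isUnitary_rightRegular ν) P.space,
      rightRegular_adelicCenter_toLp_lineThetaLift_charCM L N H e₁ dV hdV hdV0 g hg μ hμ a hρ μW Φ ν u χ, map_smul]
  -- `R(u·1_H) w = ψ(u) • w` (central character)
  have hψw : (adelicGroupData (↥(maximalRealSubfield L)) L (IsCMField.complexConj L) N H).rightRegular ν
      (adelicCenter (↥(maximalRealSubfield L)) L (IsCMField.complexConj L) N H u) w = ((ψ u : ℂˣ) : ℂ) • w := by
    have h := congrArg Subtype.val (hψ u ⟨w, hwmem⟩)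
    rw [ContRepresentation.ClosedSubrep.coe_toContRep_apply] at h
    exact h
  have hw0 : w ≠ 0 := hpr
  rw [hψw] at hR
  exact smul_left_injective ℂ hw0 hR

end Seam

/-! ## §5 «`χ_∞ = 1`» for the theta character of a holomorphic-cotangent `P` (N = 3, the frame of (C♯)hol) -/

section Hol

variable (L : Type) [Field L] [NumberField L] [IsCMField L] (ι : L →+* ℂ) (H : Matrix (Fin 3) (Fin 3) L) (T : GL (Fin 3) ℂ)
  (hT : (T : Matrix (Fin 3) (Fin 3) ℂ)ᴴ * H.map ι * (T : Matrix (Fin 3) (Fin 3) ℂ) = Literature.Geometry.ComplexHyperbolic.BallModel.J)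
  {n' : ℕ} (e₁ : Fin 3 × Fin 1 ≃ Fin n') (dV : Fin 3 → L) (hdV : ∀ i, IsCMField.complexConj L (dV i) = dV i)
  (hdV0 : ∀ i, dV i ≠ 0) (g : GL (Fin 3) L)
  (hg : ((g : Matrix (Fin 3) (Fin 3) L).map (cmConjRingHom L))ᵀ * H * (g : Matrix (Fin 3) (Fin 3) L) = Matrix.diagonal dV)
  (μ : Literature.NumberTheory.Automorphic.IdeleClassGroup L →ₜ* Circle) (hμ : IsConjugateSymplectic L μ) (a : (↥(maximalRealSubfield L))ˣ)
  (hρ : HasThetaMajorants fun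
      (p : ↥(UnitaryGroup.adelic (↥(maximalRealSubfield L)) L (IsCMField.complexConj L) 3 (Matrix.diagonal dV)) × ↥(UnitaryGroup.adelic (↥(maximalRealSubfield L)) L (IsCMField.complexConj L) 1 (JW (↥(maximalRealSubfield L)) L a))) (Φ : piSchwartzBruhat (↥(maximalRealSubfield L)) (Fin n')) => (pairRep (↥(maximalRealSubfield L)) L (IsCMField.complexConj L) 3 1 e₁ (Matrix.diagonal dV) (JW (↥(maximalRealSubfield L)) L a)
          (chiSplittingLine L e₁ dV hdV hdV0 (toHeckeCharacter L μ) (isUnitary_toHeckeCharacter L μ)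
            ((isOscillatorChar_toHeckeCharacter_iff μ).mpr hμ) (TW (↥(maximalRealSubfield L)) a)
            (isUnit_det_TW (↥(maximalRealSubfield L)) a) (JW (↥(maximalRealSubfield L)) L a) (JW_eq (↥(maximalRealSubfield L)) L a))) p Φ)

variable
  [CompactSpace (↥(UnitaryGroup.adelic (↥(maximalRealSubfield L)) L (IsCMField.complexConj L) 3 (Matrix.diagonal dV)) ⧸ (UnitaryGroup.toAdelic (↥(maximalRealSubfield L)) L (IsCMField.complexConj L) 3 (Matrix.diagonal dV)).range)] [MeasurableSpace (↥(UnitaryGroup.adelic (↥(maximalRealSubfield L)) L (IsCMField.complexConj L) 1 (JW (↥(maximalRealSubfield L)) L a)) ⧸ (UnitaryGroup.toAdelic (↥(maximalRealSubfield L)) L (IsCMField.complexConj L) 1 (JW (↥(maximalRealSubfield L)) L a)).range)] (μW : Measure (↥(UnitaryGroup.adelic (↥(maximalRealSubfield L)) L (IsCMField.complexConj L) 1 (JW (↥(maximalRealSubfield L)) L a)) ⧸ (UnitaryGroup.toAdelic (↥(maximalRealSubfield L)) L (IsCMField.complexConj L) 1 (JW (↥(maximalRealSubfield L)) L a)).r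ange))
  (Φ : piSchwartzBruhat (↥(maximalRealSubfield L)) (Fin n'))

variable [BorelSpace (↥(UnitaryGroup.adelic (↥(maximalRealSubfield L)) L (IsCMField.complexConj L) 1 (JW (↥(maximalRealSubfield L)) L a)) ⧸ (UnitaryGroup.toAdelic (↥(maximalRealSubfield L)) L (IsCMField.complexConj L) 1 (JW (↥(maximalRealSubfield L)) L a)).range)] [IsFiniteMeasure μW]
  [SMulInvariantMeasure ↥(UnitaryGroup.adelic (↥(maximalRealSubfield L)) L (IsCMField.complexConj L) 1 (JW (↥(maximalRealSubfield L)) L a)) (↥(UnitaryGroup.adelic (↥(maximalRealSubfield L)) L (IsCMField.complexConj L) 1 (JW (↥(maximalRealSubfield L)) L a)) ⧸ (UnitaryGroup.toAdelic (↥(maximalRealSubfield L)) L (IsCMField.complexConj L) 1 (JW (↥(maximalRealSubfield L)) L a)).range) μW]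

set_option maxHeartbeats 1600000 in
/-- **«`χ_∞ = 1`» for the theta character** [Liu2021, l. 2137]: in (C♯)hol's frame (`N = 3`, `(ι, H, T)`, archimedean factor
`(cmArchSection, cmCompactFactor)`), if the discrete automorphic `P` contains the coordinates of a holomorphic cotangent form `Φ_h` one of
whose classes is non-zero (★ `ContainsForm`; `H¹`-cohomological of holomorphic type) and the projection to `P` of the theta vector
`[Θ̃_Φ(χ̃) ∘ ιA]` is non-zero, then the continuous unitary character `χ̃` of `[U(⟨a⟩)]` is TRIVIAL on the archimedean norm-one units:
`χ̃([(y, 1)·1_W]) = 1` — §4 (`χ̃([u·1_W]) = ψ_P(u)`, ★ B3-core `exists_centralCharacter_adelicCenter`) and B4 (★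
`CotangentForms.centralCharacter_archCentre_eq_one`: `ψ_P((y,1)) = 1`). [cite: Liu2021, proof of Prop. 4.13 Case 1 l. 2137] [cite: BorelJacquet1979, §4.6] -/
theorem charCM_archCentre_eq_one_of_holCotForm
    [CompactSpace (adelicGroupData (↥(maximalRealSubfield L)) L (IsCMField.complexConj L) 3 H).automorphicQuotient]
    (ν : Measure (adelicGroupData (↥(maximalRealSubfield L)) L (IsCMField.complexConj L) 3 H).automorphicQuotient)
    [(adelicGroupData (↥(maximalRealSubfield L)) L (IsCMField.complexConj L) 3 H).IsAutomorphicMeasure ν]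
    (P : DiscreteAutomorphicRep (adelicGroupData (↥(maximalRealSubfield L)) L (IsCMField.complexConj L) 3 H) ν)
    {Φh : (adelicGroupData (↥(maximalRealSubfield L)) L (IsCMField.complexConj L) 3 H).Adelic → (Fin 2 → ℂ)}
    (hΦh : Φh ∈ holCotForms (↥(maximalRealSubfield L)) L (IsCMField.complexConj L) 3 H (cmArchSection L ι H T hT)
      (cmCompactFactor L ι H T hT))
    {j : Fin 2} (hj : MemLp (toQuotFun (adelicGroupData (↥(maximalRealSubfield L)) L (IsCMField.complexConj L) 3 H) fun x => Φh x j) 2 ν)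
    (hjmem : hj.toLp _ ∈ P.space.toSubmodule) (hjne : hj.toLp _ ≠ 0) :
    haveI := normal_range_toAdelic_JW L a
    ∀ (χ : PontryaginDual (↥(UnitaryGroup.adelic (↥(maximalRealSubfield L)) L (IsCMField.complexConj L) 1 (JW (↥(maximalRealSubfield L)) L a)) ⧸ (UnitaryGroup.toAdelic (↥(maximalRealSubfield L)) L (IsCMField.complexConj L) 1 (JW (↥(maximalRealSubfield L)) L a)).range)),
      P.space.toSubmodule.starProjection
          (MemLp.toLp _ (memLp_toQuotFun_lineThetaLift L 3 H e₁ dV hdV hdV0 g hg μ hμ a hρ μW Φ (charCM χ) ν 2)) ≠ 0 →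
      ∀ y : ↥(relNormOneInfUnits (↥(maximalRealSubfield L)) L),
        χ (QuotientGroup.mk (adelicCenter (↥(maximalRealSubfield L)) L (IsCMField.complexConj L) 1 (JW (↥(maximalRealSubfield L)) L a)
          ((cmAdelicOneEquivRelNormOne L).symm (relNormOneInfToIdeles (↥(maximalRealSubfield L)) L y)))) = 1 := by
  haveI := normal_range_toAdelic_JW L a
  intro χ hpr y
  obtain ⟨ψ, -, -, -, hψ⟩ := P.exists_centralCharacter_adelicCenter
  have h1 := centralCharacter_eq_charCM L 3 H e₁ dV hdV hdV0 g hg μ hμ a hρ μW Φ ν P hψ χ hpr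
    ((cmAdelicOneEquivRelNormOne L).symm (relNormOneInfToIdeles (↥(maximalRealSubfield L)) L y))
  have h2 := centralCharacter_archCentre_eq_one L ι H T hT (μ := ν) P hψ hΦh hj hjmem hjne y
  apply Circle.ext
  rw [← h1, h2, Units.val_one, Circle.coe_one]

end Hol

end Literature.NumberTheory.Automorphic.Liu2021

end
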